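import Summits.BirchSwinnertonDyer.BirchSwinnertonDyer.Theorems.EisensteinPrimesB11L3MainConjecture
import HarnessLib

/-!
# Row B11 = cell X2c (rank 1, Eisenstein, `p ‖ N`): the lever-L3 certificate ALSO gives SCHNEIDER'S CONJECTURE for THE
# Stein–Wuthrich §4.2 height and finiteness of `Ш(E/ℚ)[p^∞]` at the pair (cell `bsd-eis`, seat `bsd-eis-k5-p3` gen 2;
# route `EisensteinPrimes`, crux 4 `BSDpOnCellC` = stmt-BirchSwinnertonDyer-19034; THEOREMS ONLY; companion of
# `EisensteinPrimesB11L3MainConjecture.lean` p546788, split off for the 400-line rule)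

HONEST FRAMING (FULL-BSD rank-≤1 programme D-0033, cell `bsd-eis`). Nothing is booked here and no label or count moves;
X2c stays CONSTRUCTION-SHAPED; nothing is proved for any curve unconditionally. Inputs BY NAME: Wuthrich 2014 Thm. 16 (`hWu`),
Stein–Wuthrich 2013 Thm. 6.1 (`hJs` / `hJn`), GZK (`hGZK`), modular parametrisation (`hpar`) — binders of the K5 route's
`PublishedInputs`; no new fact. `B11L3.isUnit_cofactor_of_leadingTerm_certificate` (p546788) returns, besides the unit cofactor,
`ord_{T=0} f_E = r`; Stein–Wuthrich Thm. 6.1 clause 2 converts that into non-degeneracy of THE canonical cyclotomic height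
(Schneider's conjecture for the §4.2 datum `Dh`) and `#Ш(E/ℚ)[p^∞] < ∞`. So at an L3-certified rank-one X2 pair the C1 rider
(«modulo Schneider») of the cyclotomic roads is DISCHARGED by the certificate itself, for the height datum the roads consume.
References: [Wuthrich2014] Thm. 16 (p. 397); [SteinWuthrich2013] Thm. 6.1 (p. 20), §3.1 (p. 9), §4.2; [Schneider1985].
-/

set_option autoImplicit false
set_option linter.dupNamespace false

noncomputable section

open scoped Classical MatrixGroups ModularForm

open WeierstrassCurve PowerSeries CongruenceSubgroup
  Literature.NumberTheory.EllipticCurves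
  Literature.NumberTheory.EllipticCurves.ModularForms
  Literature.NumberTheory.EllipticCurves.Rank1Residual
  Literature.NumberTheory.EllipticCurves.Rank1Residual.Typed
  Literature.NumberTheory.EllipticCurves.Wuthrich2014
  Literature.NumberTheory.EllipticCurves.SteinWuthrich2013
  Summit.BirchSwinnertonDyer.Rank1Residual
  Summit.BirchSwinnertonDyer.Rank1Residual.X2

namespace Summit.BirchSwinnertonDyer.BirchSwinnertonDyer.Theorems.B11L3

variable (W : WeierstrassCurve ℚ) [W.IsElliptic] [W.IsGloballyMinimal] (p : ℕ) [Fact p.Prime]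

/-! ## The same certificate gives SCHNEIDER'S CONJECTURE for THE §4.2 height and `#Ш(E/ℚ)[p^∞] < ∞` at the pair

`isUnit_cofactor_of_leadingTerm_certificate` also returns `ord_{T=0} f_E = r`; Stein–Wuthrich Thm. 6.1 clause 2 converts that
into non-degeneracy of THE canonical cyclotomic height (Schneider's conjecture for `Dh`) and finiteness of `Ш(E/ℚ)[p^∞]`. So the C1
rider («modulo Schneider») of every cyclotomic rank-one road is DISCHARGED at an L3-certified pair by the certificate itself — for the
Stein–Wuthrich height datum, which is the one the roads consume. -/

/-- **SPLIT `p ‖ N`, rank one, `E[p]` reducible: the L3 certificate ⟹ Schneider(Dh) ∧ `#Ш[p^∞] < ∞` for EVERY split-canonical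
§4.2 height datum `Dh`** (the `hcert` of the p534013 door; `hpar` supplies the newform and `ϖ`). [cite: Wuthrich2014, Thm. 16 (p. 397)]
[cite: SteinWuthrich2013, Thm. 6.1 (p. 20) and §4.2] -/
theorem schneider_and_finite_sha_of_thm16_of_l3Certificate_split
    (hWu : thm16_charIdeal_dvd_multiplicative_of_reducible) (hJs : thm61_splitMultiplicative)
    (hGZK : rank_eq_analyticRank_of_analyticRank_le_one) (hpar : nonempty_modularParametrizationData)
    (hp2 : p ≠ 2) (hsplit : W.HasSplitMultiplicativeReductionAtPrime p)
    (hred : ¬ W.HasIrreducibleModPGaloisRep p) (hr1 : W.analyticRank = 1)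
    (hcert : ∀ {N : ℕ} [NeZero N] (f : CuspForm (Gamma0 N) 2), IsNewformOf W f →
      ∀ (ϖ : ℚ), (ϖ : ℝ) * W.realPeriodRat = plusPeriod f →
      ∀ (L : PowerSeries ℚ_[p]), IsSplitMultPAdicLFunctionOf f p L →
      ∀ (Dq : TateParameterData W p) (Dh : PAdicHeightData W p), IsSplitMultCanonical Dh Dq →
        L.order = ((2 : ℕ) : ℕ∞) ∧
        (((ϖ : ℚ) : ℚ_[p]) * PowerSeries.coeff 2 L *
            (padicLog p (cyclotomicGenerator p) ^ 2 * (W.torsionOrder : ℚ_[p]) ^ 2)).valuation =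
          (LInvariant Dq * (W.tamagawaProduct : ℚ_[p]) * padicRegulator Dh).valuation)
    (Dq : TateParameterData W p) (Dh : PAdicHeightData W p) (hDh : IsSplitMultCanonical Dh Dq) :
    SchneiderConjecture Dh ∧ Finite (AddCommGroup.primaryComponent W.sha p) := by
  obtain ⟨κ, hκ, γ, hγ, hγ'⟩ := exists_isCyclotomic_isTopGenerator_isCyclotomicVariable_holds p
  obtain ⟨D⟩ := W.nonempty_selmerDualData_holds κ γ hγ
  haveI : NeZero (W.conductorNorm ℤ) := ⟨(W.conductorNorm_pos_holds).ne'⟩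
  obtain ⟨Dm⟩ := hpar W
  obtain ⟨ϖ, hϖpos, hϖ, -⟩ := Dm.exists_rat_mul_realPeriodRat_eq_plusPeriod
  obtain ⟨L, hL⟩ := exists_isSplitMultPAdicLFunctionOf hsplit Dm.isNewformOf
  haveI : Module.Finite (IwasawaAlgebra p) D.X := D.module_finite_holds hγ
  obtain ⟨hX, -, hKs⟩ := hWu W p hp2 hsplit.hasMultiplicativeReductionAtPrime hred hκ hγ hγ' Dm.isNewformOf D ϖ hϖ
  haveI : (Literature.NumberTheory.EllipticCurves.Module.charIdeal (IwasawaAlgebra p) D.X).IsPrincipal :=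
    charIdeal_isPrincipal_holds p D.X
  obtain ⟨fE, hfE⟩ := Submodule.IsPrincipal.principal
    (Literature.NumberTheory.EllipticCurves.Module.charIdeal (IwasawaAlgebra p) D.X)
  have hchar : D.charIdeal = Ideal.span {fE} := hfE
  have hrank : W.mordellWeilRank = 1 := by rw [(hGZK W hr1.le).1, hr1]
  have hϖQ : ((ϖ : ℚ) : ℚ_[p]) ≠ 0 := by exact_mod_cast hϖpos.ne'
  obtain ⟨g, hgmem, hιg⟩ := hKs hsplit L hL
  have hgmem' : g ∈ Ideal.span {fE} := by rw [← hchar]; exact hgmem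
  obtain ⟨h, hgh⟩ := Ideal.mem_span_singleton'.mp hgmem'
  obtain ⟨hordL, hval⟩ := hcert Dm.f Dm.isNewformOf ϖ hϖ L hL Dq Dh hDh
  have hXk := X_pow_mordellWeilRank_dvd_of_charIdeal_eq_span W p hγ D hX hchar
  have h𝓛A : LInvariant Dq * (W.tamagawaProduct : ℚ_[p]) ≠ 0 :=
    mul_ne_zero (LInvariant_ne_zero_holds Dq) (by exact_mod_cast (W.tamagawaProduct_pos').ne')
  have hι : PowerSeries.C ((ϖ : ℚ) : ℚ_[p]) * L =
      PowerSeries.X ^ 1 * iwasawaToPowerSeries p (h * fE) := by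
    rw [hgh, ← hιg, map_mul, pow_one]
    simp [iwasawaToPowerSeries, PowerSeries.map_X]
  obtain ⟨-, hordfE⟩ := isUnit_cofactor_of_leadingTerm_certificate W p fE h L _ hϖQ 1
    W.mordellWeilRank hι (by rw [hrank]; exact hordL) _ _ (padicRegulator Dh) h𝓛A hXk
    (hJs.leadingTerm_shape hp2 Dq hκ hγ hγ' D hX hDh fE hchar) (by rw [hrank]; exact hval)
  exact (hJs.order_eq_iff hp2 Dq hκ hγ hγ' D hX hDh hchar).mp (by exact_mod_cast hordfE)

/-- **NON-split `p ‖ N`, rank one, `E[p]` reducible: the L3 certificate ⟹ Schneider(Dh) ∧ `#Ш[p^∞] < ∞` for the §4.2 height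
`Dh` of the Tate parameter** (the `hcert` of the p534013 non-split door). [cite: Wuthrich2014, Thm. 16 (p. 397)]
[cite: SteinWuthrich2013, Thm. 6.1 (p. 20), §3.1 (p. 9) and §4.2] -/
theorem schneider_and_finite_sha_of_thm16_of_l3Certificate_nonsplit
    (hWu : thm16_charIdeal_dvd_multiplicative_of_reducible) (hJn : thm61_nonsplitMultiplicative)
    (hGZK : rank_eq_analyticRank_of_analyticRank_le_one) (hpar : nonempty_modularParametrizationData)
    (hp2 : p ≠ 2) (hmult : W.HasMultiplicativeReductionAtPrime p)
    (hns : ¬ W.HasSplitMultiplicativeReductionAtPrime p)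
    (hred : ¬ W.HasIrreducibleModPGaloisRep p) (hr1 : W.analyticRank = 1)
    (hcert : ∀ {N : ℕ} [NeZero N] (f : CuspForm (Gamma0 N) 2), IsNewformOf W f →
      ∀ (ϖ : ℚ), (ϖ : ℝ) * W.realPeriodRat = plusPeriod f →
      ∀ (L : PowerSeries ℚ_[p]), IsMultPAdicLFunctionOf f p (-1) L →
      ∀ (q : ℚ_[p]), q ≠ 0 → ‖q‖ < 1 → tateJ q = (W.j : ℚ_[p]) →
      ∀ (Dh : PAdicHeightData W p), IsMultCanonical Dh q →
        L.order = ((1 : ℕ) : ℕ∞) ∧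
        (((ϖ : ℚ) : ℚ_[p]) * PowerSeries.coeff 1 L *
            (padicLog p (cyclotomicGenerator p) ^ 1 * (W.torsionOrder : ℚ_[p]) ^ 2)).valuation =
          (2 * (W.tamagawaProduct : ℚ_[p]) * padicRegulator Dh).valuation)
    {q : ℚ_[p]} (hq0 : q ≠ 0) (hq1 : ‖q‖ < 1) (hqj : tateJ q = (W.j : ℚ_[p]))
    (Dh : PAdicHeightData W p) (hDh : IsMultCanonical Dh q) :
    SchneiderConjecture Dh ∧ Finite (AddCommGroup.primaryComponent W.sha p) := by
  obtain ⟨κ, hκ, γ, hγ, hγ'⟩ := exists_isCyclotomic_isTopGenerator_isCyclotomicVariable_holds p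
  obtain ⟨D⟩ := W.nonempty_selmerDualData_holds κ γ hγ
  haveI : NeZero (W.conductorNorm ℤ) := ⟨(W.conductorNorm_pos_holds).ne'⟩
  obtain ⟨Dm⟩ := hpar W
  obtain ⟨ϖ, hϖpos, hϖ, -⟩ := Dm.exists_rat_mul_realPeriodRat_eq_plusPeriod
  obtain ⟨L, hL⟩ := exists_isMultPAdicLFunctionOf_neg_one_of_nonsplit Dm.isNewformOf hmult hns
  haveI : Module.Finite (IwasawaAlgebra p) D.X := D.module_finite_holds hγ
  obtain ⟨hX, hKns, -⟩ := hWu W p hp2 hmult hred hκ hγ hγ' Dm.isNewformOf D ϖ hϖ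
  haveI : (Literature.NumberTheory.EllipticCurves.Module.charIdeal (IwasawaAlgebra p) D.X).IsPrincipal :=
    charIdeal_isPrincipal_holds p D.X
  obtain ⟨fE, hfE⟩ := Submodule.IsPrincipal.principal
    (Literature.NumberTheory.EllipticCurves.Module.charIdeal (IwasawaAlgebra p) D.X)
  have hchar : D.charIdeal = Ideal.span {fE} := hfE
  have hrank : W.mordellWeilRank = 1 := by rw [(hGZK W hr1.le).1, hr1]
  have hϖQ : ((ϖ : ℚ) : ℚ_[p]) ≠ 0 := by exact_mod_cast hϖpos.ne'
  obtain ⟨g, hgmem, hιg⟩ := hKns hns L hL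
  have hgmem' : g ∈ Ideal.span {fE} := by rw [← hchar]; exact hgmem
  obtain ⟨h, hgh⟩ := Ideal.mem_span_singleton'.mp hgmem'
  obtain ⟨hordL, hval⟩ := hcert Dm.f Dm.isNewformOf ϖ hϖ L hL q hq0 hq1 hqj Dh hDh
  have hXk := X_pow_mordellWeilRank_dvd_of_charIdeal_eq_span W p hγ D hX hchar
  have h2A : (2 : ℚ_[p]) * (W.tamagawaProduct : ℚ_[p]) ≠ 0 :=
    mul_ne_zero two_ne_zero (by exact_mod_cast (W.tamagawaProduct_pos').ne')
  have hι : PowerSeries.C ((ϖ : ℚ) : ℚ_[p]) * L =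
      PowerSeries.X ^ 0 * iwasawaToPowerSeries p (h * fE) := by
    rw [hgh, pow_zero, one_mul, hιg]
  obtain ⟨-, hordfE⟩ := isUnit_cofactor_of_leadingTerm_certificate W p fE h L _ hϖQ 0
    W.mordellWeilRank hι (by rw [hrank, Nat.add_zero]; exact hordL) _ _ (padicRegulator Dh) h2A hXk
    (hJn.leadingTerm_shape hp2 hmult hns hq0 hq1 hqj hκ hγ hγ' D hX hDh fE hchar)
    (by rw [hrank, Nat.add_zero]; exact hval)
  exact (hJn.order_eq_iff hp2 hmult hns hq0 hq1 hqj hκ hγ hγ' D hX hDh hchar).mp (by exact_mod_cast hordfE)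

end Summit.BirchSwinnertonDyer.BirchSwinnertonDyer.Theorems.B11L3

end
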